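/-
Copyright (c) 2026 the pub-hodgecm-mathlib formalisation cell (harness21).  Prover seat hodgecm-mathlib-LH5-p03 (g7); dealer LH4-plan (g7) (LAYER C (C4), fixed-point
assembly), 2026-09-02.  Count-neutral base layer of the dyadic (D-UNR) column (FINDINGS #6∕#6′ of the LH4 board).
-/
import Literature.NumberTheory.Automorphic.UnitaryThreeFixedPointsCount            -- ★ (F3c-C9-inst) B-p04: the Flicker-frame file; its GENERIC transports are CITED by name
import Literature.NumberTheory.Automorphic.UnitaryThreeKHFactorizationTrace       -- ★ p851872 LH4-p03 (g8): Prop. 8 (i) `hKPM` ∕ `hMK` for the 2-free level elements `u_m^{(y,z)}`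
import HarnessLib

/-!
# Flicker's Cor. 9, COUNTED, for the 2-free level elements `u_m^{(y,z)}`: `#{x ∈ H ⧸ H^K_m : t·x = x} = Σᶠᵢ [T : T ∩ rᵢ K_H rᵢ⁻¹] · #{w ∈ P_H ⧸ (P_H ∩ H^K_m) : w̃⁻¹ (rᵢ⁻¹ t rᵢ) w̃ ∈ H^K_m}`
(Flicker, *Elementary proof of the fundamental lemma for a unitary group* (1998), Cor. 9 p. 85; Prop. 6 p. 83; Prop. 8 p. 84 — at every residue characteristic)

Topic `NumberTheory/Automorphic`; namespace `Literature.NumberTheory.Automorphic.UnitaryGroup`.  THEOREMS ONLY (no `def`, no instance, no notation, no named fact,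
no `sorry`; one `synthInstance.maxHeartbeats` bump for the `MulAction` instance on `↥H ⧸ M`, as in ★).  Cell `pub/hodgecm-mathlib`, crux H413 = `stmt-HodgeConjecture-24833`;
LH4 board (D-UNR), LAYER C block (C4) «FIXED-POINT ASSEMBLY, TRACE FRAME», file C4-1 of CENSUS-C4 684e921fb7106247 §4 (LH5-p03 (g7)), CENSUS-LAYERB-3of3 4277d501 §4 row
«fixed-point assembly», CENSUS-R1 52a4c879 §0.2∕§4, FINDING #6′: the TWIN of ★ `UnitaryThreeFixedPointsCount` (B-p04, Flicker frame `u_m`, `y·σy = −2`, `|2| = 1` through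
`LocalConjDatum`) over ★ `UnramifiedLocalConjDatum σ ϖ` + the characteristic token `(h2 : (2 : K) ≠ 0)` and the 2-free level elements
`u = u_m^{(y,z)} = !![ϖ^m, y, z·ϖ^{−m}; 0, 1, −σy·ϖ^{−m}; 0, 0, ϖ^{−m}]` (`z + σz + yσy = 0`, `|y| = 1`, `|z| ≤ 1`) of ★ `UnitaryThreeDoubleCosetsHKTrace` ∕ ★
`UnitaryThreeKHFactorizationTrace`.  WHAT CHANGES: only the two Prop-8 inputs — `hMK : H^K_m ≤ K_H` is ★ `mem_unitaryInt_of_flickerU_of_rel_conj_mem`, `hKPM : K_H ⊆ P_H·H^K_m`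
is ★ `exists_upper_mul_of_mem_centralizer_unitaryInt_of_rel` (both p851872, every residue characteristic).  WHAT IS CITED BY NAME (2-free in ★ already): the generic count ★
`DoubleCosetFixedPoints.natCard_fixedPoints_eq_finsum_relIndex_mul` (p840967), the transports ★ `natCard_cosets_subgroupOf_eq` ∕ `inv_mul_mul_mem_iff_of_mem`, the inclusions ★
`flickerPH_le_flickerKH` ∕ `flickerKH_le_centralizer`, the DEFS ★ `flickerKH ∕ flickerHK ∕ flickerPH` (applied to the NEW `u`; no new definition).  The conclusion of the head is
★ `natCard_fixedPoints_centralizer_eq_finsum`'s BYTE FOR BYTE with the one renaming `um ↦ u`; `hA` ∕ `hB` (Prop. 6 (a)(b)) and `hfin` stay hypotheses exactly as in ★ (they are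
discharged at the trace torus by the LAYER B 3∕3 files F2∕F3∕F4 in file C4-2).  HONEST LABEL: HC_CM is proved only modulo the printed citations (hLiu418 =
`stmt-HodgeConjecture-24832`, h413 = `stmt-HodgeConjecture-24833`) until rung 0 closes; structure theory, pays no organ, opens no road ((D-UNR) stays PRINT by D74′); the COUNT
heads of the (C6) reader contract stay hypotheses until LAYER C's last brick.

* `flickerHK_le_flickerKH_of_rel` — `H^K_m ≤ K_H` for `u_m^{(y,z)}` (★ p851872 `mem_unitaryInt_of_flickerU_of_rel_conj_mem` as an inclusion of subgroups).
* `exists_mem_flickerPH_mul_mem_flickerHK_of_rel` — Prop. 8 (i) as `hKPM` inside `↥H` (★ p851872 `exists_upper_mul_of_mem_centralizer_unitaryInt_of_rel`).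
* **`natCard_fixedPoints_centralizer_eq_finsum_of_rel (hJ) (hd) (h2) (hy) (hzv) (hz) (m) (hu) (hc) (r) (t) (T) (ht) (hA) (hB) (hfin)`** — the displayed identity, inner sets
  `{w : ↥(flickerPH σ J c) ⧸ (flickerHK σ J c u).subgroupOf _ // (↑(out w))⁻¹ * ↑((r i)⁻¹ * t * r i) * ↑(out w) ∈ flickerHK σ J c u}` VERBATIM as in ★ ∕ Prop. 10.

## References
* [Flicker1998UnitaryFL] Y. Z. Flicker, *Elementary proof of the fundamental lemma for a unitary group*, Canad. J. Math. 50 (1998), Prop. 4 p. 81, Prop. 6 p. 83, Prop. 8 p. 84,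
  Cor. 9 p. 85.
-/

set_option autoImplicit false

open scoped MatrixGroups WithZero
open Matrix

namespace Literature.NumberTheory.Automorphic

namespace UnitaryGroup

open Literature.NumberTheory.Automorphic.HermitianLattice (unitaryInt mem_unitaryInt_iff UnramifiedLocalConjDatum)
open Literature.NumberTheory.Automorphic.DoubleCosetFixedPoints

section FrameTrace

variable {K : Type*} [Field K] [Valued K ℤᵐ⁰] {ϖ : K} (σ : K →+* K) {J : Matrix (Fin 3) (Fin 3) K}

/-- **`H^K_m ≤ K_H`** for the 2-free level element `u = u_m^{(y,z)}` (`z + σz + yσy = 0`, `|y| = 1`, `|z| ≤ 1`): ★ `mem_unitaryInt_of_flickerU_of_rel_conj_mem` as an inclusion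
of subgroups.  Twin of ★ `flickerHK_le_flickerKH` (Flicker frame `z = 1`, `yσy = −2`); the hypothesis `hMK` of ★ `natCard_fixedPoints_eq_finsum_relIndex_mul`.
[cite: Flicker1998UnitaryFL, Prop. 4 p. 81; Prop. 8 p. 84] -/
theorem flickerHK_le_flickerKH_of_rel (hJ : J = (StdForm.antidiagonal 3).over K) (hd : UnramifiedLocalConjDatum σ ϖ) (h2 : (2 : K) ≠ 0)
    {y z : K} (hy : Valued.v y = 1) (hzv : Valued.v z ≤ 1) (hz : z + σ z + y * σ y = 0) (m : ℕ)
    {u c : ↥(unitaryGroupOfForm σ J)}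
    (hu : ((u : GL (Fin 3) K) : Matrix (Fin 3) (Fin 3) K) = !![ϖ ^ m, y, z * (ϖ ^ m)⁻¹; 0, 1, -σ y * (ϖ ^ m)⁻¹; 0, 0, (ϖ ^ m)⁻¹])
    (hc : ((c : GL (Fin 3) K) : Matrix (Fin 3) (Fin 3) K) = !![1, 0, 0; 0, -1, 0; 0, 0, 1]) :
    flickerHK σ J c u ≤ flickerKH σ J c := by
  intro h hh
  rw [mem_flickerHK_iff] at hh
  exact mem_flickerKH_iff.2 ⟨hh.1, mem_unitaryInt_of_flickerU_of_rel_conj_mem σ hJ hd h2 hy hzv hz m hu hc hh.1 hh.2⟩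

/-- **Prop. 8 (i) as the hypothesis `hKPM` inside `H`, for `u = u_m^{(y,z)}`**: every `k ∈ K_H` is `p · x` with `p ∈ P_H`, `x ∈ H^K_m` (all read in `↥H`) — ★
`exists_upper_mul_of_mem_centralizer_unitaryInt_of_rel` (the 2-free pivot `r := δ + γz`).  Twin of ★ `exists_mem_flickerPH_mul_mem_flickerHK`.
[cite: Flicker1998UnitaryFL, Prop. 8 p. 84] -/
theorem exists_mem_flickerPH_mul_mem_flickerHK_of_rel (hJ : J = (StdForm.antidiagonal 3).over K) (hd : UnramifiedLocalConjDatum σ ϖ) (h2 : (2 : K) ≠ 0)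
    {y z : K} (hy : Valued.v y = 1) (hzv : Valued.v z ≤ 1) (hz : z + σ z + y * σ y = 0) (m : ℕ)
    {u c : ↥(unitaryGroupOfForm σ J)}
    (hu : ((u : GL (Fin 3) K) : Matrix (Fin 3) (Fin 3) K) = !![ϖ ^ m, y, z * (ϖ ^ m)⁻¹; 0, 1, -σ y * (ϖ ^ m)⁻¹; 0, 0, (ϖ ^ m)⁻¹])
    (hc : ((c : GL (Fin 3) K) : Matrix (Fin 3) (Fin 3) K) = !![1, 0, 0; 0, -1, 0; 0, 0, 1])
    (k : ↥(Subgroup.centralizer ({c} : Set ↥(unitaryGroupOfForm σ J))))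
    (hk : k ∈ (flickerKH σ J c).subgroupOf (Subgroup.centralizer ({c} : Set ↥(unitaryGroupOfForm σ J)))) :
    ∃ p ∈ (flickerPH σ J c).subgroupOf (Subgroup.centralizer ({c} : Set ↥(unitaryGroupOfForm σ J))),
      ∃ x ∈ (flickerHK σ J c u).subgroupOf (Subgroup.centralizer ({c} : Set ↥(unitaryGroupOfForm σ J))), k = p * x := by
  rw [Subgroup.mem_subgroupOf, mem_flickerKH_iff] at hk
  obtain ⟨p, x, ⟨hpH, hpK, hp20⟩, ⟨hxH, hxu⟩, hkpx⟩ := exists_upper_mul_of_mem_centralizer_unitaryInt_of_rel σ hJ hd h2 hy hzv hz m hu hc hk.1 hk.2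
  refine ⟨⟨p, hpH⟩, ?_, ⟨x, hxH⟩, ?_, Subtype.ext hkpx⟩
  · rw [Subgroup.mem_subgroupOf, mem_flickerPH_iff h2 hc, mem_flickerKH_iff]
    exact ⟨⟨hpH, hpK⟩, hp20⟩
  · rw [Subgroup.mem_subgroupOf, mem_flickerHK_iff]
    exact ⟨hxH, hxu⟩

end FrameTrace

section CorNineTrace

variable {K : Type*} [Field K] [Valued K ℤᵐ⁰] {ϖ : K} (σ : K →+* K) {J : Matrix (Fin 3) (Fin 3) K}

set_option synthInstance.maxHeartbeats 120000 in
/-- **FLICKER'S COR. 9, COUNTED, FOR THE 2-FREE LEVEL ELEMENTS `u_m^{(y,z)}` (every residue characteristic).**  `U = U(σ, Φ₃)`, `H = Z_U(c)`, `c = diag(1,−1,1)`, `K_H`, `P_H` as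
in ★ DEFS, `H^K_m = flickerHK σ J c u` for `u = !![ϖ^m, y, zϖ^{−m}; 0, 1, −σy ϖ^{−m}; 0, 0, ϖ^{−m}]` with `z + σz + yσy = 0`, `|y| = 1`, `|z| ≤ 1`; `t ∈ H`, `T ≤ H` centralising
`t`, representatives `r : ι → H` with `H = ⊔ᵢ T·rᵢ·K_H` (Prop. 6: existence `hA`, disjointness `hB`), finitely many fixed points.  Then
`#{x ∈ H ⧸ H^K_m : t·x = x} = Σᶠᵢ [T : T ∩ rᵢ K_H rᵢ⁻¹] · #{w ∈ P_H ⧸ (P_H ∩ H^K_m) : w̃⁻¹ (rᵢ⁻¹ t rᵢ) w̃ ∈ H^K_m}` — the conclusion of ★ `natCard_fixedPoints_centralizer_eq_finsum`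
byte for byte with `um ↦ u`.  This is ★ `natCard_fixedPoints_eq_finsum_relIndex_mul` at `G := ↥H` with `hMK` ∕ `hPK` ∕ `hKPM` discharged by ★ p851872 (Prop. 8 (i) for
`u_m^{(y,z)}`) and the inner count transported by ★ `natCard_cosets_subgroupOf_eq`.  Twin of ★ `natCard_fixedPoints_centralizer_eq_finsum` (Flicker frame).
[cite: Flicker1998UnitaryFL, Cor. 9 p. 85; Prop. 6 p. 83; Prop. 8 p. 84] -/
theorem natCard_fixedPoints_centralizer_eq_finsum_of_rel (hJ : J = (StdForm.antidiagonal 3).over K) (hd : UnramifiedLocalConjDatum σ ϖ) (h2 : (2 : K) ≠ 0)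
    {y z : K} (hy : Valued.v y = 1) (hzv : Valued.v z ≤ 1) (hz : z + σ z + y * σ y = 0) (m : ℕ)
    {u c : ↥(unitaryGroupOfForm σ J)}
    (hu : ((u : GL (Fin 3) K) : Matrix (Fin 3) (Fin 3) K) = !![ϖ ^ m, y, z * (ϖ ^ m)⁻¹; 0, 1, -σ y * (ϖ ^ m)⁻¹; 0, 0, (ϖ ^ m)⁻¹])
    (hc : ((c : GL (Fin 3) K) : Matrix (Fin 3) (Fin 3) K) = !![1, 0, 0; 0, -1, 0; 0, 0, 1])
    {ι : Type*} (r : ι → ↥(Subgroup.centralizer ({c} : Set ↥(unitaryGroupOfForm σ J))))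
    (t : ↥(Subgroup.centralizer ({c} : Set ↥(unitaryGroupOfForm σ J))))
    (T : Subgroup ↥(Subgroup.centralizer ({c} : Set ↥(unitaryGroupOfForm σ J)))) (ht : ∀ τ ∈ T, τ * t = t * τ)
    (hA : ∀ g : ↥(Subgroup.centralizer ({c} : Set ↥(unitaryGroupOfForm σ J))), ∃ i, ∃ τ ∈ T,
      ∃ k ∈ (flickerKH σ J c).subgroupOf (Subgroup.centralizer ({c} : Set ↥(unitaryGroupOfForm σ J))), g = τ * r i * k)
    (hB : ∀ i j, ∀ τ ∈ T, ∀ τ' ∈ T, ∀ k ∈ (flickerKH σ J c).subgroupOf (Subgroup.centralizer ({c} : Set ↥(unitaryGroupOfForm σ J))),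
      ∀ k' ∈ (flickerKH σ J c).subgroupOf (Subgroup.centralizer ({c} : Set ↥(unitaryGroupOfForm σ J))), τ * r i * k = τ' * r j * k' → i = j)
    (hfin : {x : ↥(Subgroup.centralizer ({c} : Set ↥(unitaryGroupOfForm σ J))) ⧸
      (flickerHK σ J c u).subgroupOf (Subgroup.centralizer ({c} : Set ↥(unitaryGroupOfForm σ J))) | t • x = x}.Finite) :
    Nat.card {x : ↥(Subgroup.centralizer ({c} : Set ↥(unitaryGroupOfForm σ J))) ⧸
        (flickerHK σ J c u).subgroupOf (Subgroup.centralizer ({c} : Set ↥(unitaryGroupOfForm σ J))) // t • x = x} =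
      ∑ᶠ i, (((flickerKH σ J c).subgroupOf (Subgroup.centralizer ({c} : Set ↥(unitaryGroupOfForm σ J)))).map
          (MulAut.conj (r i)).toMonoidHom).relIndex T *
        Nat.card {w : ↥(flickerPH σ J c) ⧸ (flickerHK σ J c u).subgroupOf (flickerPH σ J c) //
          ((Quotient.out w : ↥(flickerPH σ J c)) : ↥(unitaryGroupOfForm σ J))⁻¹ *
              (((r i)⁻¹ * t * r i : ↥(Subgroup.centralizer ({c} : Set ↥(unitaryGroupOfForm σ J)))) : ↥(unitaryGroupOfForm σ J)) *
            (Quotient.out w : ↥(flickerPH σ J c)) ∈ flickerHK σ J c u} := by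
  have hPH : flickerPH σ J c ≤ Subgroup.centralizer ({c} : Set ↥(unitaryGroupOfForm σ J)) :=
    (flickerPH_le_flickerKH σ c).trans (flickerKH_le_centralizer σ c)
  have hMK : (flickerHK σ J c u).subgroupOf (Subgroup.centralizer ({c} : Set ↥(unitaryGroupOfForm σ J))) ≤
      (flickerKH σ J c).subgroupOf (Subgroup.centralizer ({c} : Set ↥(unitaryGroupOfForm σ J))) :=
    Subgroup.subgroupOf_mono _ (flickerHK_le_flickerKH_of_rel σ hJ hd h2 hy hzv hz m hu hc)
  have hPK : (flickerPH σ J c).subgroupOf (Subgroup.centralizer ({c} : Set ↥(unitaryGroupOfForm σ J))) ≤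
      (flickerKH σ J c).subgroupOf (Subgroup.centralizer ({c} : Set ↥(unitaryGroupOfForm σ J))) :=
    Subgroup.subgroupOf_mono _ (flickerPH_le_flickerKH σ c)
  rw [natCard_fixedPoints_eq_finsum_relIndex_mul T _ _ _ r t ht hMK hPK
    (fun k hk => exists_mem_flickerPH_mul_mem_flickerHK_of_rel σ hJ hd h2 hy hzv hz m hu hc k hk) hA hB hfin]
  refine finsum_congr fun i => ?_
  rw [natCard_cosets_subgroupOf_eq _ _ _ hPH]

end CorNineTrace

end UnitaryGroup

end Literature.NumberTheory.Automorphic
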